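/-
Origin: expansion seat `planner-pub-hodgecm-pv03-g2-0`, handover 2026-08-18T05:21:14Z (`HOME/pub-hodgecm-pv03-g2/lean/Pv03g2/PerL34/CharSpansFinal.lean`, md5 f994bf3e, 192 lines);
landed by the gen-6 packager in gate run 23 as `HodgeCM/PerL34/CharSpansFinal.lean` (import ^import Pv[0-9]+g[0-9]+copy\.(?:PerL34\.)?→import HodgeCM.PerL34. ×2; import ^import CarverG[0-9]+copy\.PerL34\.→import HodgeCM.PerL34. ×1; stripped 6 #print/#check/#eval lines).
-/
/-
Origin: planner-pub-hodgecm-pv03-g2-0 (unit pub-hodgecm-pv03-g2, DAG-NODE PROVER #03 gen 2; node N33 = PerL v5 Prop 4.3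
`prop:S12`, tex ll. 639–642, pf ll. 643–682), 2026-08-18.  WIP path
`HOME/pub-hodgecm-pv03-g2/lean/Pv03g2/PerL34/CharSpansFinal.lean`; proposed tree path `HodgeCM/PerL34/CharSpansFinal.lean`
(NEW, ADDITIVE; lands AFTER pv02-g3 `CharSpansCR`, pv01-g2 `RealApproximationWeil`, carver-g2 `AssemblyRoutes`).
PACKAGER: the three WIP imports below become `import HodgeCM.PerL34.CharSpansCR`,
`import HodgeCM.PerL34.RealApproximationWeil`, `import HodgeCM.PerL34.AssemblyRoutes` (`Pv02g3copy.` / `Pv01g2copy.` /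
`CarverG2copy.` are byte-identical vendored copies of pv02-g3 73d2a010 + cffde95e, pv01-g2 013e71d5789c, carver-g2 bae41223
with only their own WIP import lines re-prefixed; they are NOT to be landed from my directory).
KERNEL: nothing cited, nothing posited; pure composition of landed / queued theorems BY NAME.
-/
import Summits.HodgeConjecture.HodgeCM.PerL34.CharSpansCR
import Summits.HodgeConjecture.HodgeCM.PerL34.RealApproximationWeil
import Summits.HodgeConjecture.HodgeCM.PerL34.AssemblyRoutes

/-!
# Seam S1, FINAL FORM: the per-context residual of node N33 with BOTH kernel consumptions applied

Node N33 (`T.Open_thetaWedge`, PerL v5 Prop 4.3) is proved on the ball route from a per-context residual input.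
pv03's `CharSpansWeil.WeilStepsInput T` (run 22) was that residual after seams S1/S2 were wired by name; two seats
then consumed one conjunct each, in KERNEL, in two separate files:

* pv02-g3 `CharSpansCR` (`WeilStepsInputCR T`): the free datum `Hol`, the forms dictionary `FD`, `hHol`, the (X2)
  binder `hX2` and the conjunct `HolFrame` are THEOREMS for the canonical ball dictionary `BallCR.ballFD`
  (`BallCR.holomorphicOfPminus_ball`, `BallCR.holFrame_of_hol_eq`);
* pv01-g2 `RealApproximationWeil` (`WeilStepsInputΔ T`): the PRINT conjunct `Dense Δ` (real approximation for `G_U`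
  at `ι₁`, ll. 672–677) is a THEOREM (`RealApproximation.dense_map_fst_range`, Cayley transform) once `Γ` is what PerL
  says it is (l. 657): the image of `G_U(L₀)` in `U(2,1) × G_c × G_f`.

This file applies both at once — `WeilStepsInputCRΔ T` — and records the implications to each of the three earlier
residuals, node N33 from it on the route-agnostic realisation input `T.Open_chars` (carver-g2 `AssemblyRoutes`), and
ONE top-level corollary `perL_of_openCharsWeilLeavesCRΔ` = carver-g2's `perL_of_openCharsWeilLeaves` with
`hW : WeilStepsInputCRΔ T`.  Nothing new is proved about the mathematics; the point is that the writer and the referees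
have ONE theorem whose S1 binder is the dictionary floor and nothing else.

Direction, for the record: `WeilStepsInputCRΔ T → WeilStepsInput T` (not conversely).  The final residual is not a
logically weaker Prop than pv03's — it FIXES the forms dictionary to the canonical `BallCR.ballFD` and `Γ` to the image
of `G_U(L₀)`, which is what PerL's text says they are (ll. 650–657); what disappears are the PROP-valued binders (X2),
`hHol`, `HolFrame`, `Dense Δ`, which are THEOREMS for these canonical choices, and the free datum `Hol`.

## Binder-level census of `WeilStepsInputCRΔ T` (what is LEFT of node N33 per good context `(V, c)`)

Per good context the residual asks for data `M : CharSpansCR.CharLineSpansCR T V c` and a package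
`CharSpansCR.WeilPackageCR T M`, plus four Props.  Field by field (labels as in LEMMAS.md §3/§9):

| binder | content | label |
|---|---|---|
| `M.Gc`, `M.Gf`, `M.Γ`, `M.ThetaP`, `M.lvl`, `M.cls` | the compact factors, `G_U(𝔸_f)`, the image of `G_U(L₀)`, the slices `Θ_i(χ)[𝔭₊]` as `ℂ²`-valued functions on `U(2,1) × G_c × G_f`, level and class maps | DATA of the function model (DEFINITIONAL dictionary D1/D2/D6: PerL's objects read as functions / levels / classes) |
| `P.S`, `P.Mk`, `P.hM`, `P.Kc`, `P.P`, `P.ρP`, `P.ωinf`, `P.ρ` | Fock–Schwartz model spaces, theta-kernel models with the slices of `M`, `K_c`, the `K`-type `𝔭₊` and the actions | DATA (DEFINITIONAL, §3.2 of PerL) |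
| `P.W i χ : WeilTyping …` | `Θ`, `hθ` (`θ_φ(x) = Θ(ω(x)φ)`, l. 264–266: DEFINITIONAL); `hmulI/C/F`, `hcommIC/IF/CF/K` ("`ω` is a representation of the product group", l. 342 / §3.2: PRINT, Weil 1964); `hP` (`S[𝔭₊ ⊠ 𝟏]`: DEFINITIONAL) | DEFINITIONAL + PRINT |
| `P.hΘ` | N10 in invariant form: `Θ ∘ ω(γ) = Θ` for `γ ∈ Γ` (the theta distribution is invariant under the image of `G_U(L₀)`; consumed by pv14 `WeilTyping.leftInvariant`) | NODE N10 (§3.2 theta set-up, ll. 259–268: DEFINITIONAL D4 per audit pv07-A1) + PRINT (automorphy of the theta kernel, Weil 1964) |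
| `P.hX1 i χ` | (X1) for `BallCR.ballFD`: every `u_F`, `F ∈ Θ_i(χ)[𝔭₊]`, is the frame reading of a real-differentiable form on `𝔹²` killed by the `𝔭₋`-operators ⟺ (`CharSpansCR.thetaPKilled_ballFD_iff`, KERNEL) "`u_F` is a holomorphic one-form on `𝔹²`" (tex ll. 650–657) | INPUT(N31) + PRINT [BW] VI 4.9/4.11 via pv14 `P43X1Bridge` / pv14-g2 `P43Leaves.KTypeBridge` |
| `P.hne` | `SomeNonzero`: for each `i` some slice `Θ_i(χ)[𝔭₊]` is `≠ ⊥` (⟺ `∀ i, ∃ χ, ∃ φ ∈ S[𝔭₊ ⊠ 𝟏], θ_φ(χ'_i) ≠ 0`, pv14-g2 `P43Leaves.someNonzero_iff_thetaNe`) | INPUT(N30) (L4.2(a) ll. 528–529: characters `χ'_i` of type `e(Ψ_i)` exist) + INPUT(N33a) (ll. 644–650: `Θ_i(χ'_i)[𝔭₊] ≠ 0`) |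
| `∃ Tfr hT ψ, M.Γ = ((toU21 V Tfr hT).prod ψ).range` | `Γ` is the image of `G_U(L₀) = U(V.Hm)(L)` under (frame conjugate of `ι₁`) × (some hom to the other factors), l. 657 | DEFINITIONAL (D2); density of its `U(2,1)`-projection is then KERNEL (pv01-g2) |
| `Dict_thetaClass₀ T c`, `Dict_thetaClass₁ T c` | for every ALLOWED datum `d` and every theta one-form `u ∈ gen_i d`, at every torsion-free level `Γ ≤ lvl u`, the class `cls Γ u` lies in the model's set of theta classes `T.Theta V c i Γ` (run 19 `WedgeToClasses` :137/:141) | DEFINITIONAL (D1/D2: this is what `ThetaModel.Theta` denotes, PerL §3.2 ll. 258–268) — not kernel-closable: `T.Theta` is a primitive of the `ThetaModel` signature |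
| `Dict_cupWedge` | for `u₁ ∈ gen₁ d₁`, `u₂ ∈ gen₂ d₂` descending to a torsion-free level `Γ` with `u₁ ∧ u₂ ≠ 0` somewhere on the ball, `U.cup2C … (cls Γ u₁) (cls Γ u₂) ≠ 0` (run 19 `WedgeToClasses` :151): cup of classes = class of the wedge, a non-zero holomorphic 2-form on the compact Kähler `P_Γ` has non-zero class | PRINT (Voisin, *Hodge Theory and Complex Algebraic Geometry I*, Prop. 7.5 / Cor. 7.6, Cor. 6.15; `P_Γ` compact for anisotropic `G_U`, PerL ll. 24, 71–73) + DEFINITIONAL (`U.cup2C`, `U.pms` are primitives of the `Universe` signature) |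

Everything else that node N33 ever asked for on the ball route — transitivity / isotropy / Jacobian cocycle of
`U(2,1)` on `𝔹²`, the uniformisation reading, irreducibility of the isotropy action, (X2), `HolFrame`/`HolFromBall`,
the `K`-type bridge, left/compact/finite invariance of the theta functions from the Weil typing, density of `Δ`,
Zariski-density ⇒ some product non-zero (N33e, pv01 `n33eClosed_holds`), and the passage wedge ≠ 0 ⇒ class ≠ 0 — is a
KERNEL theorem of the package (runs 18–23; see `HOME/pub-hodgecm-pv03/README.md` for the node map).
-/

set_option autoImplicit false

noncomputable section

open scoped Matrix

namespace HodgeCM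
namespace PerL34
namespace CharSpansFinal

open HodgeCM.PerL34.BallModel HodgeCM.PerL34.BallSpans HodgeCM.PerL34.BallFrame HodgeCM.PerL34.CharSpans
  HodgeCM.PerL34.CharSpansWeil HodgeCM.PerL34.CharSpansCR HodgeCM.PerL34.WedgeNonvanishing
  HodgeCM.PerL34.WedgeToClasses HodgeCM.PerL34.RealApproximation
open Literature.AlgebraicGeometry.ShimuraVarieties (unitaryGroup conjRingHomK)

variable {U : Universe} (T : U.ThetaModel)

/-- **The S1 residual of node N33, final form** (per good context): the data `M` WITHOUT `Hol` (pv02-g3), a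
`WeilPackageCR` WITHOUT `FD`/`hHol`/`hX2` (pv02-g3), the DEFINITIONAL identification of `Γ` with the image of
`G_U(L₀)` in place of `Dense Δ` (pv01-g2), and the three dictionary Props.  No `HolFrame`, no density hypothesis. -/
def WeilStepsInputCRΔ : Prop :=
  ∀ {L : CMField} {ι₁ : L →+* ℂ} (V : HermSpace3 L ι₁) (c : SeesawCtx L), T.GoodCtx ι₁ c →
    ∃ M : CharLineSpansCR T V c, Nonempty (WeilPackageCR T M) ∧
      (∃ (Tfr : GL3) (hT : (Tfr : Matrix (Fin 3) (Fin 3) ℂ)ᴴ * V.Hm.map ι₁ * Tfr = J)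
          (ψ : unitaryGroup (conjRingHomK L) V.Hm →* M.Gc × M.Gf),
          M.Γ = ((toU21 V Tfr hT).prod ψ).range) ∧
      M.toCharLineSpans.toBallSpanModel.toBallFormsModel.toFormsModelT.Dict_thetaClass₀ T c ∧
      M.toCharLineSpans.toBallSpanModel.toBallFormsModel.toFormsModelT.Dict_thetaClass₁ T c ∧
      M.toCharLineSpans.toBallSpanModel.toBallFormsModel.toFormsModelT.toFormsModel.Dict_cupWedge

/-- `WeilStepsInputCRΔ T → WeilStepsInputCR T` (pv02-g3's residual): the density conjunct is pv01-g2's KERNEL theorem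
`CharSpansWeil.dense_Δ_of_range` (real approximation by the Cayley transform). -/
theorem weilStepsInputCR_of_CRΔ (h : WeilStepsInputCRΔ T) : WeilStepsInputCR T := by
  intro L ι₁ V c hc
  obtain ⟨M, hP, ⟨Tfr, hT, ψ, hΓ⟩, h₀, h₁, hcup⟩ := h V c hc
  exact ⟨M, hP, dense_Δ_of_range M.toCharLineSpans Tfr hT ψ hΓ, h₀, h₁, hcup⟩

/-- `WeilStepsInputCRΔ T → WeilStepsInputΔ T` (pv01-g2's residual): `Hol := BallCR.Hol`, the Weil package from the
smaller one (`WeilPackageCR.toWeilPackage`: `FD := ballFD`, `hX2 := BallCR.holomorphicOfPminus_ball`), and `HolFrame`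
by `CharLineSpansCR.holFrame` — all pv02-g3, KERNEL. -/
theorem weilStepsInputΔ_of_CRΔ (h : WeilStepsInputCRΔ T) : WeilStepsInputΔ T := by
  intro L ι₁ V c hc
  obtain ⟨M, ⟨P⟩, hΓ, h₀, h₁, hcup⟩ := h V c hc
  exact ⟨M.toCharLineSpans, ⟨P.toWeilPackage⟩, M.holFrame, hΓ, h₀, h₁, hcup⟩

/-- `WeilStepsInputCRΔ T → WeilStepsInput T` (pv03's run-22 residual). -/
theorem weilStepsInput_of_CRΔ (h : WeilStepsInputCRΔ T) : WeilStepsInput T :=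
  weilStepsInput_of_CR T (weilStepsInputCR_of_CRΔ T h)

/-- pv02-g2's `CharSpanStepsInput T` from the final residual. -/
theorem charSpanStepsInput_of_CRΔ (h : WeilStepsInputCRΔ T) : CharSpanStepsInput T :=
  charSpanStepsInput_of_weil T (weilStepsInput_of_CRΔ T h)

/-- **Node N33 (`Open_thetaWedge`, PerL v5 Prop 4.3) from the final S1 residual and the realisation input
`T.Open_chars` (node N31, ANY route)** — `LevelDirected` and `N33eClosed` are the package's KERNEL theorems
`HodgeCM.levelDirected`, `n33eClosed_holds`. -/
theorem open_thetaWedge_of_CRΔ (hch : T.Open_chars) (h : WeilStepsInputCRΔ T) : T.Open_thetaWedge :=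
  open_thetaWedge_of_charSpans T HodgeCM.levelDirected n33eClosed_holds hch (charSpanStepsInput_of_CRΔ T h)

/-- Route A (PerL v5 as written): node N33 from pv13's cluster outputs and the final S1 residual. -/
theorem open_thetaWedge_of_CRΔ_cluster (h31 : ClusterOutputs T) (h : WeilStepsInputCRΔ T) : T.Open_thetaWedge :=
  open_thetaWedge_of_CRΔ T (open_chars_of_cluster T h31) h

end CharSpansFinal

/-! ## The carver's route-agnostic N34 assembly over the final S1 residual -/

namespace AssemblyRoutes

open HodgeCM.Prior.Perl34File HodgeCM.Prior.Perl34File.Perl34 HodgeCM.PerL34.ArchC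

variable {U : Universe}

/-- `N33_wedge T` from `hch : T.Open_chars` and the final S1 residual alone. -/
theorem N33_wedge_of_CRΔ_chars (T : U.ThetaModel) (hch : T.Open_chars)
    (hW : CharSpansFinal.WeilStepsInputCRΔ T) : N33_wedge T :=
  N33_wedge_of_weil_chars T hch (CharSpansFinal.weilStepsInput_of_CRΔ T hW)

/-- **PerL (node N34) from the print leaves, the instantiation records, the realisation input `T.Open_chars` and the
FINAL S1 residual** — carver-g2's `perL_of_openCharsWeilLeaves` with `hW : WeilStepsInputCRΔ T`: in `hW` no `Hol`,
no forms dictionary, no (X2), no `HolFrame`, no real-approximation leaf (see the census in the module docstring).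
Route A: `hch := open_chars_of_cluster T h31`; route B: `hch := Li92Route.open_chars_of_print T hP` (pv13-g2). -/
theorem perL_of_openCharsWeilLeavesCRΔ (M : U.ModelAxioms) (T : U.ThetaModel)
    (h07 : N07_hodgeRiemann20 U) (h09a : N09a_embCover T) (h09b : N09b_innerEmb T)
    (hM38 : U.Fact_cmInflation) (hAlb : T.Fact_thetaAlbanese) (h12b : N12b_signRecipe T)
    (hbr : ∀ {L : CMField} {ι₁ : L →+* ℂ} (V : HermSpace3 L ι₁) (c : SeesawCtx L), T.GoodCtx ι₁ c →
      Nonempty (SeesawDictionary.SeesawBridge T V c (T.t12 V c) 0 1))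
    (hQ : ∀ {L : CMField} {ι₁ : L →+* ℂ} (V : HermSpace3 L ι₁) (c : SeesawCtx L), T.GoodCtx ι₁ c →
      Nonempty (QautDictionary.QautBridge T V c (T.t34 V c) 2 3))
    (Pc : ∀ {L : CMField} {ι₁ : L →+* ℂ} (V : HermSpace3 L ι₁) (c : SeesawCtx L),
      C4a.PointedCore (T.core V c))
    (A12 : ∀ {L : CMField} {ι₁ : L →+* ℂ} (V : HermSpace3 L ι₁) (c : SeesawCtx L),
      T.GoodCtx ι₁ c → Nonempty (ArchCDatum (T.core V c) (T.t12 V c) (Pc V c)))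
    (A34 : ∀ {L : CMField} {ι₁ : L →+* ℂ} (V : HermSpace3 L ι₁) (c : SeesawCtx L),
      T.GoodCtx ι₁ c → Nonempty (ArchCDatum (T.core V c) (T.t34 V c) (Pc V c)))
    (hch : T.Open_chars) (hW : CharSpansFinal.WeilStepsInputCRΔ T) : U.PerL :=
  perL_of_openCharsWeilLeaves M T h07 h09a h09b hM38 hAlb h12b hbr hQ Pc A12 A34 hch
    (CharSpansFinal.weilStepsInput_of_CRΔ T hW)

/-- Route A instance (PerL v5 as written, Rallis N31b–N31h through pv13's `ClusterOutputs`). -/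
theorem perL_of_clusterWeilLeavesCRΔ (M : U.ModelAxioms) (T : U.ThetaModel)
    (h07 : N07_hodgeRiemann20 U) (h09a : N09a_embCover T) (h09b : N09b_innerEmb T)
    (hM38 : U.Fact_cmInflation) (hAlb : T.Fact_thetaAlbanese) (h12b : N12b_signRecipe T)
    (hbr : ∀ {L : CMField} {ι₁ : L →+* ℂ} (V : HermSpace3 L ι₁) (c : SeesawCtx L), T.GoodCtx ι₁ c →
      Nonempty (SeesawDictionary.SeesawBridge T V c (T.t12 V c) 0 1))
    (hQ : ∀ {L : CMField} {ι₁ : L →+* ℂ} (V : HermSpace3 L ι₁) (c : SeesawCtx L), T.GoodCtx ι₁ c →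
      Nonempty (QautDictionary.QautBridge T V c (T.t34 V c) 2 3))
    (Pc : ∀ {L : CMField} {ι₁ : L →+* ℂ} (V : HermSpace3 L ι₁) (c : SeesawCtx L),
      C4a.PointedCore (T.core V c))
    (A12 : ∀ {L : CMField} {ι₁ : L →+* ℂ} (V : HermSpace3 L ι₁) (c : SeesawCtx L),
      T.GoodCtx ι₁ c → Nonempty (ArchCDatum (T.core V c) (T.t12 V c) (Pc V c)))
    (A34 : ∀ {L : CMField} {ι₁ : L →+* ℂ} (V : HermSpace3 L ι₁) (c : SeesawCtx L),
      T.GoodCtx ι₁ c → Nonempty (ArchCDatum (T.core V c) (T.t34 V c) (Pc V c)))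
    (h31 : ClusterOutputs T) (hW : CharSpansFinal.WeilStepsInputCRΔ T) : U.PerL :=
  perL_of_openCharsWeilLeavesCRΔ M T h07 h09a h09b hM38 hAlb h12b hbr hQ Pc A12 A34 (open_chars_of_cluster T h31) hW

end AssemblyRoutes
end PerL34
end HodgeCM

end

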